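import Literature.MathematicalPhysics.QuantumFieldTheory.Balaban1983to89.B15HDecayLeaves
import Literature.MathematicalPhysics.QuantumFieldTheory.Balaban1983to89.B15GammaSmallness
import Literature.MathematicalPhysics.QuantumFieldTheory.Balaban1983to89.B15Ineq154Proof

/-!
# `Balaban1983to89.B15Ineq158Bound` — [Balaban1989LargeFieldI] pp. 187–188, the bound after (1.58): *"ℍ_Z^{(j)} is given
# by the formula corresponding to (1.41). It is an analytic function of the configuration U^{(k_{n+1})} restricted to Z,
# and on (Ω^c_{j+1}\Z′_j)^{(j)} it is bounded by O(1)exp(−R_j)ε_j. This bound is very small, smaller than any positive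
# power of g_j"* — DERIVED from (1.57) (hence from [15] (190)) and the (1.41)-type mechanism, with the smallness
# *"much smaller than δ′_j"* of (1.54) from the explicit γ-clause; (1.54) closed with these inputs

statement-level skeleton of published theorems with citation tags; proofs where landed; nothing here is a claim about
the Yang–Mills mass gap.

CITATION HEADER (lean-in-tree rule 2026-08-18).  T. Bałaban, *Large field renormalization. I. The basic step of the 𝐑
operation*, Commun. Math. Phys. **122**, 175–202 (1989), doi:10.1007/BF01257412, bib `Balaban1989LargeFieldI` (cell
paper B15; PDF held `paper:balaban1989-cmp122-large-field-i`; pp. 187–188 = PDF 13–14, OCR pages `p0013.txt`/`p0014.txt`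
and the x2 renders).  "[15]" = [Balaban1985Variational] (190) p. 308 (`B11SectG.Ineq190`); "[3]" = [Balaban1984PropagatorsII]
(2.61) (`B11SectG.RowSum`); "[III]" = [Balaban1988Convergent] (2.4)/(2.5)/(2.8) (`Setup.epsK`, `B14.IsRj`,
`B15.Ineq194Flow.deltaPrimeK`).  WHAT IS REPRODUCED: SKELETON rows `B15.Eq1.58` (its bound sentence) and `B15.Eq1.54`
(its second expression), unit `lit-balaban-r12` gen 8, HOME `run/shared/lean/pub/lit-balaban/`
(`lit-balaban-r12/ROWS-B15.md`).  Used BY NAME, nothing restated: `B15.BasicStep.Ineq157` (the typed leaf (1.57)),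
`B15HDecayLeaves.ineq157_first_of_ineq190` ((1.57)₁ from (190)), `B15Ineq157Flow.ineq157_of_first` ((1.57)₂ for abstract
sizes), `B14FlowStep.log_inv_sq_mono`, `B15Ineq154Proof.ineq154_full` ((1.54) from (1.27), (1.58) and the two inputs
discharged here).

THE PRINTED TEXT (pp. 187–188, verbatim): *"This field is small, because |V′_j − 1| ≤ |V_j(V_Z^{(j)})^{−1} − 1| +
|V_Z^{(j)}(V^{(j)})^{−1} − 1| < 3δ′_j (1.54) by (1.27), and by the fact that the second expression on the right-hand side
is much smaller than δ′_j. This we will show later. … |ℍ^{(n+1)}_{k,Z}| ≤ (L^{j+1}η)^{−1}B₃exp(−δ10M(R_{j+1} + ⋯ + R_{k−1})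
− δMR_k)44d²B₃ε_k < 44d²B₃²(1 + β₀)exp(−R_j)ε_j. (1.57) For the averages V^{(j)}, V_Z^{(j)} we have, as in (1.40) V^{(j)} =
exp iℍ_Z^{(j)}V_Z^{(j)}, (1.58) where ℍ_Z^{(j)} is given by the formula corresponding to (1.41). It is an analytic function
of the configuration U^{(k_{n+1})} restricted to Z, and on (Ω^c_{j+1}\Z′_j)^{(j)} it is bounded by O(1)exp(−R_j)ε_j. This
bound is very small, smaller than any positive power of g_j."*

WHAT THIS FILE PROVES (kernel-checked, zero `sorry`; no `def`, no new `Prop`, no new named fact; axioms standard).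
* §1 `boundHZ158_of_157` — schematic reals: from the leaf `Ineq157 H …` and the (1.41)-type mechanism `|ℍ_Z^{(j)}(b)| ≤
  c₄₁·H` (hypothesis `h41`, `c₄₁ ≥ 0`; lattice form of the mechanism = p29's `B15Ineq137Proof`/`B15Ineq137Local`):
  `|ℍ_Z^{(j)}(b)| ≤ c₄₁44d²B₃²(1+β₀)·exp(−R_j)ε_j` — the printed `O(1)` made explicit as `c₄₁44d²B₃²(1+β₀)`.
* §2 `boundHZ158_of_ineq190` — the same END-TO-END from [15] (190) on the `BlockNorm` carrier: (190) at every base point +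
  (2.61) + the argument field of B-size `≤ 44d²B₃ε_k` in the `2Mχ`-layer at `∂Z` at distance `≥ D` with
  `δ10M·ΣR_l + δMR_k ≤ τD` + `Cκ_Bc ≤ B₃` + mean-value domination (= `ineq157_first_of_ineq190`), then (1.57)₂ for abstract
  sizes `R_l ≥ 1`, `R_l ≤ L·R_{l+1}`, `L ≥ 2`, `δM ≥ L + 1`, the (2.8) input `ε_k ≤ (1+β₀)(k−j)^{1/2}ε_j` (= `ineq157_of_first`).
* §3 `exp_neg_R_le_gsq_pow` — *"smaller than any positive power of g_j"*: `exp(−R_j) ≤ (g_j²)^N` for every `N ≤ log g_j⁻²`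
  when `r ≥ 2` ((2.5): `R_j ≥ (log g_j⁻²)^r`); `smallness158_hyp_of_gamma`, `smallness158_of_gamma` — *"much smaller than
  δ′_j"*: `C·exp(−R_j)·ε_j < δ′_j` (`ε_j = g_jA₀(log g_j⁻²)^{p₀}`, `δ′_j = g_jA₁(log g_j⁻²)^{p₁}`, `p₁ ≤ p₀`) from (2.5) with
  `r ≥ 1`, `0 < g_j ≤ γ`, `log γ⁻² ≥ 1`, `C, A₀ ≥ 0` and the explicit clause `C·A₀·(2(p₀−p₁))^{p₀−p₁}·γ < A₁` (mechanism:
  `e^{−R} ≤ e^{−x}`, `x^q e^{−x} ≤ (2q)^q e^{−x/2}`, `e^{−x/2} ≤ e^{−(log γ⁻²)/2} = γ`, `x = log g_j⁻²`).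
* §5 (v1.1) `boundHZ158_along_flow_of_ineq190` — §2 along an actual [III] flow (`B15Ineq157Flow.ineq157_along_flow`: sizes
  `R_l = L^{s_l}` of (2.5), `ε_l = Setup.epsK A₀ p₀ F l`, the (2.8) input from `SatisfiesRG`/`SmallnessFor`).
* §4 `ineq154_of_157` / `ineq154_of_157_gamma` — **(1.54) `|V′_j(b) − 1| < 3δ′_j`** from (1.27), the representation (1.58),
  the leaf (1.57) with the mechanism constant at every bond of the region, and the γ-clause (the two displayed inputs `hHZ`,
  `hsmall` of `B15Ineq154Proof.ineq154_full` discharged in their printed form).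
HONEST SCOPE.  The (1.41)-type formula for `ℍ_Z^{(j)}` is used only through its consequence `|ℍ_Z^{(j)}(b)| ≤ c₄₁·sup|ℍ^{(n+1)}_{k,Z}|`
(hypothesis); analyticity is not typed; the identification of the `BlockNorm` size in §2 with the norm `‖ℍ_Z^{(j)}(b)‖` of §4 is
the block-size ↔ lattice-sup dictionary of `B15HDecayLeaves` (not typed).  NOT summit progress.
v1.1 (r12 gen 14, 2026-08-22): CITELOC DOCFIX ONLY — the locator «(2.5)/(2.8) p.255» of `boundHZ158_along_flow_of_ineq190` now reads «(2.5) p.255,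
(2.8) p.256» ([Balaban1988Convergent]: (2.5)–(2.7) are p. 255 = PDF 13, (2.8)/(2.9) are p. 256 = PDF 14 ll. 5–6; own sweep of the [III] key over the
directory, map = r11's render-verified ROWS-B14 page column ∩ the text layer); no declaration, statement or proof changed.
-/

namespace Literature.MathematicalPhysics.QuantumFieldTheory.Balaban1983to89.B15Ineq158Bound

open Literature.MathematicalPhysics.QuantumFieldTheory.Balaban1983to89
open B11SectG B15.BasicStep B15.PrelimIntegrations B15.Ineq194Flow B15HDecayLeaves B15Ineq157Flow B14FlowStep
  B15StandardRep B15Ineq154Proof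

/-! ## §1. The bound of (1.58) from (1.57) and the (1.41)-type mechanism -/

/-- **(1.58) p. 188**, *"ℍ_Z^{(j)} is given by the formula corresponding to (1.41) … it is bounded by O(1)exp(−R_j)ε_j"*:
with `nHZ = |ℍ_Z^{(j)}(b)|`, the (1.41)-type mechanism `nHZ ≤ c₄₁·H` (`H` the size of `ℍ^{(n+1)}_{k,Z}` entering (1.57),
`c₄₁ ≥ 0`) and the leaf (1.57) `Ineq157 H Lpow B₃ δ M sumR Rk Rj d εk εj β₀`:
`nHZ ≤ c₄₁44d²B₃²(1+β₀)·exp(−R_j)·ε_j`. [cite: Balaban1989LargeFieldI, (1.58) p.188] -/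
theorem boundHZ158_of_157 {nHZ c41 H Lpow B₃ δ M sumR Rk Rj d εk εj β₀ : ℝ}
    (h157 : Ineq157 H Lpow B₃ δ M sumR Rk Rj d εk εj β₀) (h41 : nHZ ≤ c41 * H) (hc41 : 0 ≤ c41) :
    nHZ ≤ c41 * (44 * d ^ 2 * B₃ ^ 2 * (1 + β₀)) * Real.exp (-Rj) * εj := by
  obtain ⟨h1, h2⟩ := h157
  have h3 := mul_le_mul_of_nonneg_left (h1.trans h2.le) hc41
  calc nHZ ≤ c41 * H := h41
    _ ≤ c41 * (44 * d ^ 2 * B₃ ^ 2 * (1 + β₀) * Real.exp (-Rj) * εj) := h3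
    _ = c41 * (44 * d ^ 2 * B₃ ^ 2 * (1 + β₀)) * Real.exp (-Rj) * εj := by ring

/-! ## §2. The same end-to-end from [15] (190) -/

section BlockNorms

variable {g : B6.Geometry} {FB FA : Type} [AddCommGroup FB] [Module ℝ FB] [AddCommGroup FA] [Module ℝ FA]

/-- **(1.57) ⇒ (1.58)'s bound, from [15] (190)**: for the size `bout` of `ℍ^{(n+1)}_{k,Z}` at the base point `y`, (190) at
every base point, (2.61) at rate `σ`, `τ ≥ 0` with `σ + τ ≤ ⅛δ₀`, the argument field of B-size `≤ 44d²B₃ε_k` vanishing on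
the blocks `y′` with `d(y,y′) < D`, `δ10M(R_{j+1} + ⋯ + R_{k−1}) + δMR_k ≤ τD`, `Cκ_Bc ≤ B₃`, mean-value domination
(`hmv`), sizes `R_l ≥ 1` with `R_l ≤ L·R_{l+1}`, `L ≥ 2`, `δM ≥ L + 1`, the (2.8) [III] input `ε_k ≤ (1+β₀)(k−j)^{1/2}ε_j`,
signs, and the mechanism `|ℍ_Z^{(j)}(b)| ≤ c₄₁·(L^{k−j−1}·size)` (`h41`): `|ℍ_Z^{(j)}(b)| ≤ c₄₁44d²B₃²(1+β₀)exp(−R_j)ε_j`.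
[cite: Balaban1989LargeFieldI, (1.57)–(1.58) p.188; Balaban1985Variational, (190) p.308] -/
theorem boundHZ158_of_ineq190 {T : Type*} {bB : BlockNorm g FB} {bout : BlockNorm g FA}
    {dH : T → FB →ₗ[ℝ] FA} {C δ₀ σ τ c D B₃ δ M d εk εj β₀ L nHZ c41 : ℝ} {R : ℕ → ℝ} {j k : ℕ}
    (h190 : ∀ t, Ineq190 bB bout (dH t) C δ₀) (hC : 0 ≤ C) (hd : ∀ a b : g.Site, 0 ≤ g.dist a b)
    (hrow : RowSum g σ c) (hτ : 0 ≤ τ) (hστ : σ + τ ≤ δ₀ / 8) (B : FB) (y : g.Site)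
    (hm : ∀ y', bB.loc y' B ≤ 44 * d ^ 2 * B₃ * εk) (hD : ∀ y', bB.loc y' B ≠ 0 → D ≤ g.dist y y')
    {HB : FA} (hmv : ∀ s : ℝ, (∀ t, bout.loc y (dH t B) ≤ s) → bout.loc y HB ≤ s)
    (hgeom : δ * 10 * M * (∑ l ∈ Finset.Ico (j + 1) k, R l) + δ * M * R k ≤ τ * D) (hCB : C * bB.κ * c ≤ B₃)
    (hjk : j < k) (hL : 2 ≤ L) (hδM : L + 1 ≤ δ * M) (hR1 : ∀ l, 1 ≤ R l)
    (hstep : ∀ l, j ≤ l → l < k → R l ≤ L * R (l + 1)) (hεk : εk ≤ (1 + β₀) * Real.sqrt ((k : ℝ) - j) * εj)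
    (hεk0 : 0 ≤ εk) (hεj : 0 < εj) (hβ₀ : 0 ≤ β₀) (hB₃ : 0 < B₃) (hdd : 0 < d)
    (h41 : nHZ ≤ c41 * (L ^ (k - j - 1) * bout.loc y HB)) (hc41 : 0 ≤ c41) :
    nHZ ≤ c41 * (44 * d ^ 2 * B₃ ^ 2 * (1 + β₀)) * Real.exp (-R j) * εj := by
  have hLpow : (0 : ℝ) ≤ L ^ (k - j - 1) := pow_nonneg (by linarith) _
  have hfirst := ineq157_first_of_ineq190 h190 hC hd hrow hτ hστ B y hm hD hmv hgeom hCB hLpow hB₃.le hεk0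
  have h157 := ineq157_of_first hjk hL hδM hR1 hstep hεk hεj hβ₀ hB₃ hdd hfirst
  exact boundHZ158_of_157 h157 h41 hc41

end BlockNorms

/-! ## §3. "Smaller than any positive power of g_j" and "much smaller than δ′_j" -/

/-- `x^q ≤ (2q)^q·e^{x/2}` for `x ≥ 0`. [folklore] -/
private theorem pow_le_mul_exp_half {x : ℝ} (hx : 0 ≤ x) (q : ℕ) : x ^ q ≤ (2 * q) ^ q * Real.exp (x / 2) := by
  rcases Nat.eq_zero_or_pos q with hq | hq
  · subst hq
    simpa using Real.one_le_exp (by linarith : 0 ≤ x / 2)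
  · have hq0 : (0 : ℝ) < 2 * q := by positivity
    have h1 : x / (2 * q) ≤ Real.exp (x / (2 * q)) := by linarith [Real.add_one_le_exp (x / (2 * q))]
    have h2 : (x / (2 * q)) ^ q ≤ (Real.exp (x / (2 * q))) ^ q := pow_le_pow_left₀ (by positivity) h1 q
    have h3 : (Real.exp (x / (2 * q))) ^ q = Real.exp (x / 2) := by
      rw [← Real.exp_nat_mul]; congr 1; field_simp
    rw [div_pow, h3, div_le_iff₀ (by positivity)] at h2
    linarith

/-- `e^{−x}·x^q ≤ (2q)^q·e^{−x/2}` for `x ≥ 0`. [folklore] -/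
private theorem exp_neg_mul_pow_le {x : ℝ} (hx : 0 ≤ x) (q : ℕ) :
    Real.exp (-x) * x ^ q ≤ (2 * q) ^ q * Real.exp (-(x / 2)) := by
  have h := mul_le_mul_of_nonneg_left (pow_le_mul_exp_half hx q) (Real.exp_nonneg (-x))
  have e : Real.exp (-x) * Real.exp (x / 2) = Real.exp (-(x / 2)) := by
    rw [← Real.exp_add]; congr 1; ring
  calc Real.exp (-x) * x ^ q ≤ Real.exp (-x) * ((2 * q) ^ q * Real.exp (x / 2)) := h
    _ = (2 * q) ^ q * (Real.exp (-x) * Real.exp (x / 2)) := by ring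
    _ = (2 * q) ^ q * Real.exp (-(x / 2)) := by rw [e]

/-- `exp(−log (g²)⁻¹) = g²` for `g > 0`. [folklore] -/
private theorem exp_neg_log_inv_sq {g : ℝ} (hg : 0 < g) : Real.exp (-Real.log (g ^ 2)⁻¹) = g ^ 2 := by
  rw [Real.log_inv, neg_neg, Real.exp_log (by positivity)]

/-- `exp(−½·log (g²)⁻¹) = g` for `g > 0`. [folklore] -/
private theorem exp_neg_half_log_inv_sq {g : ℝ} (hg : 0 < g) : Real.exp (-(Real.log (g ^ 2)⁻¹ / 2)) = g := by
  rw [Real.log_inv, Real.log_pow]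
  push_cast
  have : -(-(2 * Real.log g) / 2) = Real.log g := by ring
  rw [this, Real.exp_log hg]

/-- **p. 188** *"This bound is very small, smaller than any positive power of g_j"*: by (2.5) [III] `R_j ≥ (log g_j⁻²)^r`;
for `r ≥ 2`, `g_j > 0` and every natural `N ≤ log g_j⁻²`: `exp(−R_j) ≤ (g_j²)^N` (as `(log g_j⁻²)^r ≥ N·log g_j⁻²` and
`exp(−log g_j⁻²) = g_j²`). [cite: Balaban1989LargeFieldI, (1.58) p.188; Balaban1988Convergent, (2.5) p.255] -/
theorem exp_neg_R_le_gsq_pow {L r : ℕ} (hr : 2 ≤ r) {g : ℝ} {R : ℕ} (h : B14.IsRj L r g R) (hg : 0 < g)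
    {N : ℕ} (hN : (N : ℝ) ≤ Real.log (g ^ 2)⁻¹) : Real.exp (-(R : ℝ)) ≤ (g ^ 2) ^ N := by
  obtain ⟨_, _, hle, _⟩ := h
  rcases Nat.eq_zero_or_pos N with hN0 | hN0
  · subst hN0
    rw [pow_zero, Real.exp_le_one_iff, neg_nonpos]
    exact Nat.cast_nonneg R
  · set x := Real.log (g ^ 2)⁻¹ with hx
    have hx1 : 1 ≤ x := le_trans (by exact_mod_cast hN0) hN
    have h1 : (N : ℝ) * x ≤ x ^ r := by
      have h2 : (N : ℝ) ≤ x ^ (r - 1) := hN.trans (le_self_pow₀ hx1 (by omega))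
      calc (N : ℝ) * x ≤ x ^ (r - 1) * x := mul_le_mul_of_nonneg_right h2 (by linarith)
        _ = x ^ r := by rw [← pow_succ]; congr 1; omega
    have h3 : Real.exp (-(R : ℝ)) ≤ Real.exp (-((N : ℝ) * x)) := Real.exp_le_exp.mpr (by linarith [h1.trans hle])
    rw [show -((N : ℝ) * x) = (N : ℝ) * (-x) by ring, Real.exp_nat_mul, hx, exp_neg_log_inv_sq hg] at h3
    exact h3

/-- **pp. 187–188** *"the second expression on the right-hand side [of (1.54)] is much smaller than δ′_j"* — the
smallness `C·exp(−R_j)·ε_j < δ′_j` behind it, for the profiles `ε_j = g_jA₀(log g_j⁻²)^{p₀}` ((2.4) [III]) and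
`δ′_j = g_jA₁(log g_j⁻²)^{p₁}` (p. 179) with `p₁ ≤ p₀`: from (2.5) [III] (`R_j ≥ (log g_j⁻²)^r`, `r ≥ 1`), `0 < g_j ≤ γ`,
`log γ⁻² ≥ 1`, `C, A₀ ≥ 0` and the explicit clause `C·A₀·(2(p₀−p₁))^{p₀−p₁}·γ < A₁`.  Mechanism: with `x = log g_j⁻² ≥
log γ⁻² ≥ 1` and `q = p₀ − p₁`, `e^{−R_j}x^q ≤ e^{−x}x^q ≤ (2q)^q e^{−x/2} ≤ (2q)^q e^{−(log γ⁻²)/2} = (2q)^q γ`.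
[cite: Balaban1989LargeFieldI, (1.54) p.187; Balaban1988Convergent, (2.5) p.255] -/
theorem smallness158_hyp_of_gamma {γ : ℝ} {L r : ℕ} (hr : 1 ≤ r) {p₀ p₁ : ℕ} (hp : p₁ ≤ p₀) {g C A₀ A₁ : ℝ} {R : ℕ}
    (h : B14.IsRj L r g R) (hg : 0 < g) (hgγ : g ≤ γ) (hγe : 1 ≤ Real.log (γ ^ 2)⁻¹) (hC : 0 ≤ C) (hA₀ : 0 ≤ A₀)
    (hγ : C * A₀ * (2 * ((p₀ - p₁ : ℕ) : ℝ)) ^ (p₀ - p₁) * γ < A₁) :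
    C * Real.exp (-(R : ℝ)) * (g * p0Profile A₀ p₀ g) < g * p0Profile A₁ p₁ g := by
  unfold p0Profile
  obtain ⟨_, _, hle, _⟩ := h
  have hmono : Real.log (γ ^ 2)⁻¹ ≤ Real.log (g ^ 2)⁻¹ := log_inv_sq_mono hg hgγ
  have hγpos : 0 < γ := hg.trans_le hgγ
  have hhalf : Real.exp (-(Real.log (g ^ 2)⁻¹ / 2)) ≤ γ := by
    rw [← exp_neg_half_log_inv_sq hγpos]
    exact Real.exp_le_exp.mpr (by linarith)
  set x := Real.log (g ^ 2)⁻¹ with hx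
  have hx1 : 1 ≤ x := hγe.trans hmono
  have hx0 : 0 ≤ x := by linarith
  have hR : Real.exp (-(R : ℝ)) ≤ Real.exp (-x) := by
    have hxr : x ≤ x ^ r := le_self_pow₀ hx1 (by omega)
    exact Real.exp_le_exp.mpr (by linarith [hxr.trans hle])
  set q := p₀ - p₁ with hq
  have hp0 : p₀ = p₁ + q := by omega
  rw [hp0, pow_add]
  have hkey : C * Real.exp (-(R : ℝ)) * A₀ * x ^ q < A₁ := by
    have h1 : Real.exp (-(R : ℝ)) * x ^ q ≤ (2 * q) ^ q * γ :=
      calc Real.exp (-(R : ℝ)) * x ^ q ≤ Real.exp (-x) * x ^ q := mul_le_mul_of_nonneg_right hR (by positivity)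
        _ ≤ (2 * q) ^ q * Real.exp (-(x / 2)) := exp_neg_mul_pow_le hx0 q
        _ ≤ (2 * q) ^ q * γ := mul_le_mul_of_nonneg_left hhalf (by positivity)
    have h2 : C * A₀ * (Real.exp (-(R : ℝ)) * x ^ q) ≤ C * A₀ * ((2 * q) ^ q * γ) :=
      mul_le_mul_of_nonneg_left h1 (by positivity)
    calc C * Real.exp (-(R : ℝ)) * A₀ * x ^ q = C * A₀ * (Real.exp (-(R : ℝ)) * x ^ q) := by ring
      _ ≤ C * A₀ * ((2 * q) ^ q * γ) := h2
      _ = C * A₀ * (2 * (q : ℝ)) ^ q * γ := by ring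
      _ < A₁ := hγ
  have hgx : 0 < g * x ^ p₁ := by positivity
  calc C * Real.exp (-(R : ℝ)) * (g * (A₀ * (x ^ p₁ * x ^ q)))
      = (g * x ^ p₁) * (C * Real.exp (-(R : ℝ)) * A₀ * x ^ q) := by ring
    _ < (g * x ^ p₁) * A₁ := mul_lt_mul_of_pos_left hkey hgx
    _ = g * (A₁ * x ^ p₁) := by ring

section Flow

variable {F : Flow} {γ : ℝ} {K : ℕ}

/-- **pp. 187–188, along a renormalization group flow of the [III] setting**: for `j ≤ K` (`0 < g_j ≤ γ`), `R_j` as in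
(2.5) with `r ≥ 1`, `p₁ ≤ p₀`, `log γ⁻² ≥ 1`, `C, A₀ ≥ 0` and `C·A₀·(2(p₀−p₁))^{p₀−p₁}·γ < A₁`:
`C·exp(−R_j)·ε_j < δ′_j` (`ε_j = Setup.epsK A₀ p₀ F j`, `δ′_j = deltaPrimeK A₁ p₁ F j`) — the hypothesis `hsmall` of
`B15Ineq154Proof.second154_lt`/`ineq154_full`. [cite: Balaban1989LargeFieldI, (1.54) p.187; Balaban1988Convergent, (2.5) p.255] -/
theorem smallness158_of_gamma {L r : ℕ} (hr : 1 ≤ r) {p₀ p₁ : ℕ} (hp : p₁ ≤ p₀) {C A₀ A₁ : ℝ}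
    (hI : F.InInterval γ K) (hγe : 1 ≤ Real.log (γ ^ 2)⁻¹) (hC : 0 ≤ C) (hA₀ : 0 ≤ A₀)
    (hγ : C * A₀ * (2 * ((p₀ - p₁ : ℕ) : ℝ)) ^ (p₀ - p₁) * γ < A₁) {j : ℕ} (hj : j ≤ K) {R : ℕ}
    (hR : B14.IsRj L r (F.g j) R) :
    C * Real.exp (-(R : ℝ)) * epsK A₀ p₀ F j < deltaPrimeK A₁ p₁ F j := by
  obtain ⟨hg, hgγ⟩ := hI j hj
  unfold epsK deltaPrimeK
  exact smallness158_hyp_of_gamma hr hp hR hg hgγ hγe hC hA₀ hγ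

end Flow

/-! ## §4. (1.54) with its two displayed inputs discharged -/

section Group

variable {P : Params} {j : ℕ} {G : Type*} [GaugeGroup G] {𝔤 : Type*} [NormedAddCommGroup 𝔤] (χ : LieChart G 𝔤)

/-- **(1.54) p. 187**, `|V′_j(b) − 1| < 3δ′_j` on the bonds of the region `S`, from (1.27) (`SF127`), the representation
(1.58) (`Rep158`), the chart inequality (24) of [12] (`hchart`), AT EVERY BOND the leaf (1.57) for some size `H` of
`ℍ^{(n+1)}_{k,Z}` together with the (1.41)-type mechanism `‖ℍ_Z^{(j)}(b)‖ ≤ c₄₁·H` (`h157`, `c₄₁ ≥ 0`), and the smallness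
`c₄₁44d²B₃²(1+β₀)·exp(−R_j)·ε_j < δ′_j` (`hsmall`; from γ: `smallness158_of_gamma`). [cite: Balaban1989LargeFieldI, (1.54) p.187] -/
theorem ineq154_of_157 (hchart : ∀ X : 𝔤, dist1 (χ.expI X) ≤ ‖X‖) {S : Set (PBond P j)}
    {δ'j c41 B₃ d β₀ Rj εj : ℝ} {Vj VZ Vup : GaugeField P j G} {HZ : VecField P j 𝔤}
    (h127 : SF127 S δ'j Vj VZ) (h158 : Rep158 χ HZ VZ Vup)
    (h157 : ∀ b ∈ S, ∃ H Lpow δ M sumR Rk εk : ℝ, Ineq157 H Lpow B₃ δ M sumR Rk Rj d εk εj β₀ ∧ ‖HZ b‖ ≤ c41 * H)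
    (hc41 : 0 ≤ c41) (hsmall : c41 * (44 * d ^ 2 * B₃ ^ 2 * (1 + β₀)) * Real.exp (-Rj) * εj < δ'j)
    {b : PBond P j} (hb : b ∈ S) : dist1 (fluct153 Vj Vup b) < 3 * δ'j := by
  refine ineq154_full χ hchart h127 h158 (fun b' hb' => ?_) hsmall hb
  obtain ⟨H, Lpow, δ, M, sumR, Rk, εk, h1, h2⟩ := h157 b' hb'
  exact boundHZ158_of_157 h1 h2 hc41

/-- **(1.54) along a renormalization group flow of the [III] setting**, the smallness from γ: as `ineq154_of_157` with
`ε_j = Setup.epsK A₀ p₀ F j`, `δ′_j = deltaPrimeK A₁ p₁ F j`, `R_j` as in (2.5) (`r ≥ 1`), `j ≤ K`, `p₁ ≤ p₀`, `log γ⁻² ≥ 1`,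
`A₀ ≥ 0`, `β₀ ≥ −1` and the explicit clause `c₄₁44d²B₃²(1+β₀)·A₀·(2(p₀−p₁))^{p₀−p₁}·γ < A₁`.
[cite: Balaban1989LargeFieldI, (1.54) p.187; Balaban1988Convergent, (2.5) p.255] -/
theorem ineq154_of_157_gamma {F : Flow} {γ : ℝ} {K : ℕ} {L r : ℕ} (hr : 1 ≤ r) {p₀ p₁ : ℕ} (hp : p₁ ≤ p₀)
    {A₀ A₁ : ℝ} (hI : F.InInterval γ K) (hγe : 1 ≤ Real.log (γ ^ 2)⁻¹) (hA₀ : 0 ≤ A₀) (hjK : j ≤ K) {R : ℕ}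
    (hR : B14.IsRj L r (F.g j) R) (hchart : ∀ X : 𝔤, dist1 (χ.expI X) ≤ ‖X‖) {S : Set (PBond P j)}
    {c41 B₃ d β₀ : ℝ} {Vj VZ Vup : GaugeField P j G} {HZ : VecField P j 𝔤}
    (h127 : SF127 S (deltaPrimeK A₁ p₁ F j) Vj VZ) (h158 : Rep158 χ HZ VZ Vup)
    (h157 : ∀ b ∈ S, ∃ H Lpow δ M sumR Rk εk : ℝ,
      Ineq157 H Lpow B₃ δ M sumR Rk (R : ℝ) d εk (epsK A₀ p₀ F j) β₀ ∧ ‖HZ b‖ ≤ c41 * H)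
    (hc41 : 0 ≤ c41) (hβ₀ : 0 ≤ 1 + β₀)
    (hγ : c41 * (44 * d ^ 2 * B₃ ^ 2 * (1 + β₀)) * A₀ * (2 * ((p₀ - p₁ : ℕ) : ℝ)) ^ (p₀ - p₁) * γ < A₁)
    {b : PBond P j} (hb : b ∈ S) : dist1 (fluct153 Vj Vup b) < 3 * deltaPrimeK A₁ p₁ F j :=
  ineq154_of_157 χ hchart h127 h158 h157 hc41
    (smallness158_of_gamma hr hp hI hγe (by positivity) hA₀ hγ hjK hR) hb

end Group

/-! ## §5 (v1.1). (1.58)'s bound along a renormalization group flow of the [III] setting -/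

section AlongFlowBlock

variable {g : B6.Geometry} {FB FA : Type} [AddCommGroup FB] [Module ℝ FB] [AddCommGroup FA] [Module ℝ FA]

/-- **(1.57) ⇒ (1.58)'s bound FROM [15] (190), ALONG ANY RENORMALIZATION GROUP FLOW of the [III] setting**: as
`boundHZ158_of_ineq190`, with (1.57)₂ supplied by `B15Ineq157Flow.ineq157_along_flow` — (I.0.20) up to `K`, `0 < g_l ≤ γ`,
`0 ≤ β_{l+1}(g_l) ≤ β′`, `SmallnessFor γ β′ β₀ L r` and `SmallnessFor γ β′ β₀ L p₀`, sizes `R_l = L^{s_l}` as in (2.5),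
`ε_l = Setup.epsK A₀ p₀ F l` (`A₀ > 0`), `j < k ≤ K`, `δM ≥ L + 1`; the (190) data localise the argument field (B-size
`≤ 44d²B₃ε_k`) at distance `≥ D` with `δ10M·(R_{j+1} + ⋯ + R_{k−1}) + δMR_k ≤ τD`; the mechanism `|ℍ_Z^{(j)}(b)| ≤
c₄₁·(L^{k−j−1}·size)`: `|ℍ_Z^{(j)}(b)| ≤ c₄₁44d²B₃²(1+β₀)·exp(−R_j)·ε_j` with `R_j = L^{s_j}`.
[cite: Balaban1989LargeFieldI, (1.57)–(1.58) p.188; Balaban1988Convergent, (2.5) p.255, (2.8) p.256] -/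
theorem boundHZ158_along_flow_of_ineq190 (F : Flow) (K : ℕ) {γ β' β₀ : ℝ} {L r p₀ : ℕ}
    (Sr : SmallnessFor γ β' β₀ L r) (Sp : SmallnessFor γ β' β₀ L p₀)
    (hrg : F.SatisfiesRG K) (hI : F.InInterval γ K) (hub : ∀ j, j < K → F.β (j + 1) (F.g j) ≤ β')
    (hlb : ∀ j, j < K → 0 ≤ F.β (j + 1) (F.g j)) {s : ℕ → ℕ}
    (hs : ∀ j, j ≤ K → B14.IsRj L r (F.g j) (L ^ s j)) {A₀ : ℝ} (hA₀ : 0 < A₀)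
    {j k : ℕ} (hjk : j < k) (hkK : k ≤ K) {δ M B₃ d : ℝ} (hδM : (L : ℝ) + 1 ≤ δ * M) (hB₃ : 0 < B₃) (hdd : 0 < d)
    {T : Type*} {bB : BlockNorm g FB} {bout : BlockNorm g FA} {dH : T → FB →ₗ[ℝ] FA} {C δ₀ σ τ c D nHZ c41 : ℝ}
    (h190 : ∀ t, Ineq190 bB bout (dH t) C δ₀) (hC : 0 ≤ C) (hd : ∀ a b : g.Site, 0 ≤ g.dist a b)
    (hrow : RowSum g σ c) (hτ : 0 ≤ τ) (hστ : σ + τ ≤ δ₀ / 8) (B : FB) (y : g.Site)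
    (hm : ∀ y', bB.loc y' B ≤ 44 * d ^ 2 * B₃ * epsK A₀ p₀ F k) (hD : ∀ y', bB.loc y' B ≠ 0 → D ≤ g.dist y y')
    {HB : FA} (hmv : ∀ s : ℝ, (∀ t, bout.loc y (dH t B) ≤ s) → bout.loc y HB ≤ s)
    (hgeom : δ * 10 * M * (∑ l ∈ Finset.Ico (j + 1) k, (L : ℝ) ^ s l) + δ * M * (L : ℝ) ^ s k ≤ τ * D)
    (hCB : C * bB.κ * c ≤ B₃)
    (h41 : nHZ ≤ c41 * ((L : ℝ) ^ (k - j - 1) * bout.loc y HB)) (hc41 : 0 ≤ c41) :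
    nHZ ≤ c41 * (44 * d ^ 2 * B₃ ^ 2 * (1 + β₀)) * Real.exp (-(L : ℝ) ^ s j) * epsK A₀ p₀ F j := by
  have hL2 : (2 : ℝ) ≤ L := by exact_mod_cast Sr.hL
  have hLpow : (0 : ℝ) ≤ (L : ℝ) ^ (k - j - 1) := pow_nonneg (by linarith) _
  have hεk0 : 0 ≤ epsK A₀ p₀ F k :=
    (epsK_pos_of_inInterval F K (p₀ := p₀) hA₀ Sp.γ_lt_one hI hkK).le
  have hfirst := ineq157_first_of_ineq190 h190 hC hd hrow hτ hστ B y hm hD hmv hgeom hCB hLpow hB₃.le hεk0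
  have h157 := ineq157_along_flow F K Sr Sp hrg hI hub hlb hs hA₀ hjk hkK hδM hB₃ hdd hfirst
  exact boundHZ158_of_157 h157 h41 hc41

end AlongFlowBlock

end Literature.MathematicalPhysics.QuantumFieldTheory.Balaban1983to89.B15Ineq158Bound
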